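import Summits.QuantumFields.YangMills.Theorems.BalabanUVNodesN13UV01LevelZeroOfNormalisationLettersAtRecord13
import Literature.MathematicalPhysics.QuantumFieldTheory.Balaban1983to89.Node00.Record13NumericsOfThm1CCMWZB

/-!
# BalabanUVNodes ∕ N13 — [III] Cor. 3 (2.50) AT LEVEL `0` AT THE εbg-LETTER z-WITNESS FAMILY `theta13OfThm1CCMWZB … εbg … Efl logz` (DEF-1's Z3) WITH `logz` := PRINT's `log z(g_j², ε)`
# read along the LETTER-FREE member's history `gOfRecord₁₃ F N (θ₁₅ᶜᶜᴹᵂᶻᴮ(j; γ; εbg; 0, 0))` — the Z3 TWIN of dag-n13-w1's p643638 `…N13UV01LevelZeroAtThm1CCMWZOfPrintedZ` (its `εbg = 1` member)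

Cell `pub-ymgap` (D-0062 Track A), seat `pub-ymgap-dag-n24-c` (R134 N24 [B2 composite] s2, gen 16) for the K0-AT-Z3 road (plan g91 SIZING WORD I.46176: L1 p706279 ✓ · L2 · L3 · L4 = V22-Z):
item (Z-6) of this seat's LOCATED-ZB-DEPS census (I.46522) — the K1 face of record reads N13's level-0 face at the `εbg = 1` member; a V22-Z face needs it AT THE Z3 MEMBER `εbg := a₀`.
First refusal offered to the dag-n13-w1 lineage (I.46522).  Key K1⁹ `StabilityBRunRowsAtRecordR13SepCoPHV` = stmt-QuantumFields-27364 (`--kind proof --supports 27364 --as helper`; count-neutral).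
[III] = [Balaban1988Convergent]; [V] = [Balaban1989LargeFieldII]; [I] = [Balaban1987RG1]; [IV] = [Balaban1989LargeFieldI].

WHAT.  A TOKEN-PASS of p643638 (`theta13OfThm1CCMW … ↦ theta13OfThm1CCMWZB … εbg … 0 0`, `theta13OfThm1CCMWZ … Efl logz ↦ theta13OfThm1CCMWZB … εbg … Efl logz`; every proof term
VERBATIM): dag-n13-w1's CLAIM-1 `…N13UV01LevelZeroOfNormalisationLettersAtRecord13` is θ-GENERIC (`uv_zero_densOfRecord₁₃_of_logz_zNorm_of_eflAbs_of_inInterval_of_invSqFloor θ P …`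
with `hz : θ.logz P j = log z((gOfRecord₁₃ F N θ P j)², ε)` read along θ's OWN history), and the Z3 member's β ∕ histories ∕ (2.9) species ∕ backgrounds do not read the letters
`Efl`, `logz` (DEF-1 `betaOfRecord₁₃_theta13OfThm1CCMWZB_tokens`, `rfl`) — so `logz P j := log z((g_j)², ε)` with `g_j` the history of the letter-free member `θ₁₅ᶜᶜᴹᵂᶻᴮ(j; γ; εbg; 0, 0)`
is the same legitimate, non-circular printed letter as in p643638, now at every background radius `εbg` (β DOES read `εbg` — DEF-1 p685339 — so the history here is the Z3 member's own,
not the `εbg = 1` member's).  §1 ★ `zItems_theta13OfThm1CCMWZB_printedZ` · ★★ `uv_zero_densOfRecord₁₃_theta13OfThm1CCMWZB_printedZ_of_eflAbs_of_inInterval_of_invSqFloor` ·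
`…_of_runPartialSumFloor` (row (iv) spelling); §2 `…_eflZero_…` (`Efl = 0`).  At `εbg = 1` these ARE p643638's theorems (Z3 bridge `theta13OfThm1CCMWZ_eq_B`, `rfl`).

HONEST FRAMING.  Instantiation of dag-n13-w1's CLAIM-1 at DEF-1's Z3 family by `rfl`; LEVEL 0 ONLY (explicit Wilson weight); the printed `z` enters through the tree's kernel theorem
`B16ZLower.log_zNorm_specialUnitaryGroup_ge`; `Efl`'s volume bound is a displayed hypothesis (or `Efl = 0`); nothing of Bałaban's Cor. 3 above level 0 asserted; NO value of `εbg`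
chosen for anybody; this does NOT make any Z3 member a K1⁹ witness; K0⁷ V21-G texts untouched (V22-Z is the plan's ∕ k0 lanes'); K1⁹ NEITHER proved NOR refuted; N13 NOT discharged;
counts unmoved (typed 28∕28 · discharged 8∕28, 8∕27 excl. NODE O); one finite `𝕋⁴_{L^K}` programme at fixed ε; R4 closes the CONDITIONAL finite-𝕋⁴ rung `BalabanLadder.UV` only —
the Yang–Mills mass gap (Clay) is NOT proved by any of this.  No `sorry`, `def`, `instance`, `notation`; standard axioms.
-/

noncomputable section

open scoped BigOperators

namespace Summit.QuantumFields.YangMills.BalabanUVNodes.N13UV01LevelZeroAtThm1CCMWZBOfPrintedZ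

open MeasureTheory
open Literature.MathematicalPhysics.QuantumFieldTheory.Balaban1983to89
open Literature.MathematicalPhysics.QuantumFieldTheory.Balaban1983to89.T4Continuum
open Literature.MathematicalPhysics.QuantumFieldTheory.Balaban1983to89.Node00
open Literature.MathematicalPhysics.QuantumFieldTheory.Balaban1983to89.FlowStepRuns (genFlow genSeq genSeq_zero)
open Literature.MathematicalPhysics.QuantumFieldTheory.Balaban1983to89.FlowStep (HBeta prefixOf RGEqH)
open Summit.QuantumFields.YangMills.BalabanUVNodes.N13UV01LevelZeroOfNormalisationLettersAtRecord13
  (zItems_of_logz_eq_log_zNorm uv_zero_densOfRecord₁₃_of_logz_zNorm_of_eflAbs_of_inInterval_of_invSqFloor)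
open Summit.QuantumFields.YangMills.BalabanUVNodes.N13UV01LevelZeroOfPartialSumFloorAtRecord13
  (partialSumFloor_nonneg_of_inInterval inv_sq_gOfRecord₁₃_le_of_inInterval_of_runPartialSumFloor)

variable (F : T4Family) (N : ℕ) [NeZero N] (j : ℕ) (γ εbg ε₀ ε₂₉ B₃ B₃' a₀ a₁ : ℝ) (Efl logz : B12.RunParams → ℕ → ℝ)

/-! ## §1 (The Z3 member's β ∕ histories do not read the letters `Efl`, `logz`: `betaOfRecord₁₃ (θZB … Efl logz) = betaOfRecord₁₃ (θZB … 0 0)` by `rfl` — DEF-1's `K1ZBWitnessBetaRadius.betaOfRecord₁₃_theta13OfThm1CCMWZB_tokens`; the histories `gOfRecord₁₃` likewise, by unfolding.)  The printed `z` as the open letter: both z-items, and (2.50) at level `0` for every volume-bounded `Efl` -/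

/-- ★ **AT THE Z MEMBER WITH `logz P j := log z(g_j², ε)` ALONG THE BLIND MEMBER's HISTORY, BOTH z-ITEMS HOLD ON EVERY γ'-WINDOWED RUN** (`γ' ≤ 1`, `0 < ε`): z-LOWER with
print's `aL = d(𝔤)`, `CzL = C_z^{SU}(N, ε)`; z-UPPER with `aU = CzU = 0`.  CLAIM-1's `zItems_of_logz_eq_log_zNorm` through the `rfl` bridges. [cite: Balaban1987RG1, (0.14)–(0.17) pp.254–255] -/
theorem zItems_theta13OfThm1CCMWZB_printedZ {ε : ℝ} (hε : 0 < ε) (P : B12.RunParams) {γ' : ℝ} (hγ' : γ' ≤ 1)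
    (hI : (genFlow (betaOfRecord₁₃ F N (theta13OfThm1CCMWZB F N j γ εbg ε₀ ε₂₉ B₃ B₃' a₀ a₁ (fun _ _ => 0) (fun _ _ => 0))) P.g0).InInterval γ' P.K) :
    (∀ i, i < P.K → ((dimSU N : ℕ) : ℝ) * Real.log (gOfRecord₁₃ F N (theta13OfThm1CCMWZB F N j γ εbg ε₀ ε₂₉ B₃ B₃' a₀ a₁ (fun _ _ => 0) (fun _ _ => 0)) P i) - B16ZLower.CzSU N ε ≤
        (theta13OfThm1CCMWZB F N j γ εbg ε₀ ε₂₉ B₃ B₃' a₀ a₁ Efl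
          (fun p i => Real.log (B16ZLower.zNorm (SU N) (gOfRecord₁₃ F N (theta13OfThm1CCMWZB F N j γ εbg ε₀ ε₂₉ B₃ B₃' a₀ a₁ (fun _ _ => 0) (fun _ _ => 0)) p i ^ 2) ε))).logz P i) ∧
      (∀ i, i < P.K → (theta13OfThm1CCMWZB F N j γ εbg ε₀ ε₂₉ B₃ B₃' a₀ a₁ Efl
          (fun p i => Real.log (B16ZLower.zNorm (SU N) (gOfRecord₁₃ F N (theta13OfThm1CCMWZB F N j γ εbg ε₀ ε₂₉ B₃ B₃' a₀ a₁ (fun _ _ => 0) (fun _ _ => 0)) p i ^ 2) ε))).logz P i ≤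
        (0 : ℝ) * Real.log (gOfRecord₁₃ F N (theta13OfThm1CCMWZB F N j γ εbg ε₀ ε₂₉ B₃ B₃' a₀ a₁ (fun _ _ => 0) (fun _ _ => 0)) P i) + 0) :=
  zItems_of_logz_eq_log_zNorm (theta13OfThm1CCMWZB F N j γ εbg ε₀ ε₂₉ B₃ B₃' a₀ a₁ Efl
    (fun p i => Real.log (B16ZLower.zNorm (SU N) (gOfRecord₁₃ F N (theta13OfThm1CCMWZB F N j γ εbg ε₀ ε₂₉ B₃ B₃' a₀ a₁ (fun _ _ => 0) (fun _ _ => 0)) p i ^ 2) ε))) P hε (fun _ _ => rfl) hγ' hI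

/-- ★★ **(2.50) AT LEVEL `0` AT THE Z MEMBER WITH THE PRINTED `z` AND ANY VOLUME-BOUNDED `Efl`** (`|Efl_P(i)| ≤ C_E·|T₁^{(i+1)}|` for `i < K`), along a γ'-windowed run (`γ' ≤ 1`) under the
coupling floor `g_i⁻² ≤ g₀⁻² + M` (`0 ≤ M`): `χβ₀·exp(−g₀⁻²A^η₀ − em·|T₁^{(0)}|) ≤ ρ₀ ≤ exp(ep·|T₁^{(0)}|)`, `em = 4·max(log σ₀,0) + C_z^{SU}(N,ε) + C_E + 12g₀⁻²`, `ep = 4d(𝔤)(log g₀⁻¹ + M∕2)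
+ 4·max(−log σ₀,0) + C_E` — CLAIM-1 §5 at this `θ`. [cite: Balaban1989LargeFieldII, (0.1) pp.355–356; Balaban1988Convergent, (2.50) p.264, Thm 1 p.262, (1.15) p.249; Balaban1987RG1, (0.15) p.254, (0.20) p.256] -/
theorem uv_zero_densOfRecord₁₃_theta13OfThm1CCMWZB_printedZ_of_eflAbs_of_inInterval_of_invSqFloor {ε CE γ' M : ℝ} (hε : 0 < ε) (hCE : 0 ≤ CE) (hγ' : γ' ≤ 1) (hM : 0 ≤ M)
    (P : B12.RunParams) (hE : ∀ i, i < P.K → |Efl P i| ≤ CE * sitesCard (F.P P.K) (i + 1))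
    (hfl : ∀ i, i ≤ P.K → (gOfRecord₁₃ F N (theta13OfThm1CCMWZB F N j γ εbg ε₀ ε₂₉ B₃ B₃' a₀ a₁ (fun _ _ => 0) (fun _ _ => 0)) P i ^ 2)⁻¹ ≤ (P.g0 ^ 2)⁻¹ + M)
    (hI : (genFlow (betaOfRecord₁₃ F N (theta13OfThm1CCMWZB F N j γ εbg ε₀ ε₂₉ B₃ B₃' a₀ a₁ (fun _ _ => 0) (fun _ _ => 0))) P.g0).InInterval γ' P.K) (U : GaugeField (F.P P.K) 0 (SU N)) :
    chiβOfRecord₁₃ F N (theta13OfThm1CCMWZB F N j γ εbg ε₀ ε₂₉ B₃ B₃' a₀ a₁ (fun _ _ => 0) (fun _ _ => 0)) P.K (gOfRecord₁₃ F N (theta13OfThm1CCMWZB F N j γ εbg ε₀ ε₂₉ B₃ B₃' a₀ a₁ (fun _ _ => 0) (fun _ _ => 0)) P) 0 U *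
          Real.exp (-(1 / (gOfRecord₁₃ F N (theta13OfThm1CCMWZB F N j γ εbg ε₀ ε₂₉ B₃ B₃' a₀ a₁ (fun _ _ => 0) (fun _ _ => 0)) P 0)) ^ 2 *
              wilsonBGOfRecord F N (theta13OfThm1CCMWZB F N j γ εbg ε₀ ε₂₉ B₃ B₃' a₀ a₁ (fun _ _ => 0) (fun _ _ => 0)).εbg P 0 U
            - (4 * max (numerics7OfThm1CCM F.L j ε₀ B₃ B₃' a₀ a₁).logσ₀ 0 + B16ZLower.CzSU N ε + CE
                + 12 * (1 / gOfRecord₁₃ F N (theta13OfThm1CCMWZB F N j γ εbg ε₀ ε₂₉ B₃ B₃' a₀ a₁ (fun _ _ => 0) (fun _ _ => 0)) P 0) ^ 2) * (Fintype.card (Site (F.P P.K) 0) : ℝ)) ≤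
        densOfRecord₁₃ F N (theta13OfThm1CCMWZB F N j γ εbg ε₀ ε₂₉ B₃ B₃' a₀ a₁ Efl
          (fun p i => Real.log (B16ZLower.zNorm (SU N) (gOfRecord₁₃ F N (theta13OfThm1CCMWZB F N j γ εbg ε₀ ε₂₉ B₃ B₃' a₀ a₁ (fun _ _ => 0) (fun _ _ => 0)) p i ^ 2) ε))) P 0 U ∧
      densOfRecord₁₃ F N (theta13OfThm1CCMWZB F N j γ εbg ε₀ ε₂₉ B₃ B₃' a₀ a₁ Efl
          (fun p i => Real.log (B16ZLower.zNorm (SU N) (gOfRecord₁₃ F N (theta13OfThm1CCMWZB F N j γ εbg ε₀ ε₂₉ B₃ B₃' a₀ a₁ (fun _ _ => 0) (fun _ _ => 0)) p i ^ 2) ε))) P 0 U ≤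
        Real.exp ((4 * ((dimSU N : ℕ) : ℝ) * (Real.log (gOfRecord₁₃ F N (theta13OfThm1CCMWZB F N j γ εbg ε₀ ε₂₉ B₃ B₃' a₀ a₁ (fun _ _ => 0) (fun _ _ => 0)) P 0)⁻¹ + M / 2)
            + 4 * max (-(numerics7OfThm1CCM F.L j ε₀ B₃ B₃' a₀ a₁).logσ₀) 0 + CE) * (Fintype.card (Site (F.P P.K) 0) : ℝ)) :=
  uv_zero_densOfRecord₁₃_of_logz_zNorm_of_eflAbs_of_inInterval_of_invSqFloor
    (theta13OfThm1CCMWZB F N j γ εbg ε₀ ε₂₉ B₃ B₃' a₀ a₁ Efl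
      (fun p i => Real.log (B16ZLower.zNorm (SU N) (gOfRecord₁₃ F N (theta13OfThm1CCMWZB F N j γ εbg ε₀ ε₂₉ B₃ B₃' a₀ a₁ (fun _ _ => 0) (fun _ _ => 0)) p i ^ 2) ε)))
    P hγ' hM hε hCE hfl hI (fun _ _ => rfl) hE U

/-- **THE SAME FROM ROW (iv) IN K1⁹'s INLINE SPELLING** (run-wise partial-sum floor of the blind member's `β` at level `γ₀`, `γ' ≤ γ₀`; p632548 §1 gives the coupling floor, `0 ≤ M`).
[cite: Balaban1989LargeFieldII, (0.1) pp.355–356; Balaban1988Convergent, (2.50) p.264; Balaban1987RG1, (0.20) p.256, Thm 2 p.259, (0.15) p.254] -/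
theorem uv_zero_densOfRecord₁₃_theta13OfThm1CCMWZB_printedZ_of_eflAbs_of_inInterval_of_runPartialSumFloor {ε CE γ' γ₀ M : ℝ} (hε : 0 < ε) (hCE : 0 ≤ CE) (hγ' : γ' ≤ 1)
    (hγ₀ : γ' ≤ γ₀) (P : B12.RunParams) (hE : ∀ i, i < P.K → |Efl P i| ≤ CE * sitesCard (F.P P.K) (i + 1))
    (hps : ∀ (n : ℕ) (gs : ℕ → ℝ), RGEqH n (betaOfRecord₁₃ F N (theta13OfThm1CCMWZB F N j γ εbg ε₀ ε₂₉ B₃ B₃' a₀ a₁ (fun _ _ => 0) (fun _ _ => 0))) gs → Step.InInterval γ₀ n gs →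
      ∀ k, k ≤ n → -M ≤ ∑ i ∈ Finset.Ico k n, betaOfRecord₁₃ F N (theta13OfThm1CCMWZB F N j γ εbg ε₀ ε₂₉ B₃ B₃' a₀ a₁ (fun _ _ => 0) (fun _ _ => 0)) i (prefixOf gs i))
    (hI : (genFlow (betaOfRecord₁₃ F N (theta13OfThm1CCMWZB F N j γ εbg ε₀ ε₂₉ B₃ B₃' a₀ a₁ (fun _ _ => 0) (fun _ _ => 0))) P.g0).InInterval γ' P.K) (U : GaugeField (F.P P.K) 0 (SU N)) :
    chiβOfRecord₁₃ F N (theta13OfThm1CCMWZB F N j γ εbg ε₀ ε₂₉ B₃ B₃' a₀ a₁ (fun _ _ => 0) (fun _ _ => 0)) P.K (gOfRecord₁₃ F N (theta13OfThm1CCMWZB F N j γ εbg ε₀ ε₂₉ B₃ B₃' a₀ a₁ (fun _ _ => 0) (fun _ _ => 0)) P) 0 U *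
          Real.exp (-(1 / (gOfRecord₁₃ F N (theta13OfThm1CCMWZB F N j γ εbg ε₀ ε₂₉ B₃ B₃' a₀ a₁ (fun _ _ => 0) (fun _ _ => 0)) P 0)) ^ 2 *
              wilsonBGOfRecord F N (theta13OfThm1CCMWZB F N j γ εbg ε₀ ε₂₉ B₃ B₃' a₀ a₁ (fun _ _ => 0) (fun _ _ => 0)).εbg P 0 U
            - (4 * max (numerics7OfThm1CCM F.L j ε₀ B₃ B₃' a₀ a₁).logσ₀ 0 + B16ZLower.CzSU N ε + CE
                + 12 * (1 / gOfRecord₁₃ F N (theta13OfThm1CCMWZB F N j γ εbg ε₀ ε₂₉ B₃ B₃' a₀ a₁ (fun _ _ => 0) (fun _ _ => 0)) P 0) ^ 2) * (Fintype.card (Site (F.P P.K) 0) : ℝ)) ≤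
        densOfRecord₁₃ F N (theta13OfThm1CCMWZB F N j γ εbg ε₀ ε₂₉ B₃ B₃' a₀ a₁ Efl
          (fun p i => Real.log (B16ZLower.zNorm (SU N) (gOfRecord₁₃ F N (theta13OfThm1CCMWZB F N j γ εbg ε₀ ε₂₉ B₃ B₃' a₀ a₁ (fun _ _ => 0) (fun _ _ => 0)) p i ^ 2) ε))) P 0 U ∧
      densOfRecord₁₃ F N (theta13OfThm1CCMWZB F N j γ εbg ε₀ ε₂₉ B₃ B₃' a₀ a₁ Efl
          (fun p i => Real.log (B16ZLower.zNorm (SU N) (gOfRecord₁₃ F N (theta13OfThm1CCMWZB F N j γ εbg ε₀ ε₂₉ B₃ B₃' a₀ a₁ (fun _ _ => 0) (fun _ _ => 0)) p i ^ 2) ε))) P 0 U ≤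
        Real.exp ((4 * ((dimSU N : ℕ) : ℝ) * (Real.log (gOfRecord₁₃ F N (theta13OfThm1CCMWZB F N j γ εbg ε₀ ε₂₉ B₃ B₃' a₀ a₁ (fun _ _ => 0) (fun _ _ => 0)) P 0)⁻¹ + M / 2)
            + 4 * max (-(numerics7OfThm1CCM F.L j ε₀ B₃ B₃' a₀ a₁).logσ₀) 0 + CE) * (Fintype.card (Site (F.P P.K) 0) : ℝ)) :=
  uv_zero_densOfRecord₁₃_theta13OfThm1CCMWZB_printedZ_of_eflAbs_of_inInterval_of_invSqFloor F N j γ εbg ε₀ ε₂₉ B₃ B₃' a₀ a₁ Efl hε hCE hγ'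
    (partialSumFloor_nonneg_of_inInterval (theta13OfThm1CCMWZB F N j γ εbg ε₀ ε₂₉ B₃ B₃' a₀ a₁ (fun _ _ => 0) (fun _ _ => 0)) P hγ₀ hps hI) P hE
    (inv_sq_gOfRecord₁₃_le_of_inInterval_of_runPartialSumFloor (theta13OfThm1CCMWZB F N j γ εbg ε₀ ε₂₉ B₃ B₃' a₀ a₁ (fun _ _ => 0) (fun _ _ => 0)) P hγ₀ hps hI) hI U

/-! ## §2 The hypothesis-free member: `Efl = 0`, `logz` printed -/

/-- ★★ **(2.50) AT LEVEL `0` AT THE Z MEMBER `theta13OfThm1CCMWZ … 0 logz_print` WITH NO HYPOTHESIS ON THE LETTERS** — `Efl = 0` is volume-bounded with `C_E = 0`; along a γ'-windowed run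
(`γ' ≤ 1`) under the coupling floor: `em = 4·max(log σ₀,0) + C_z^{SU}(N,ε) + 12g₀⁻²`, `ep = 4d(𝔤)(log g₀⁻¹ + M∕2) + 4·max(−log σ₀,0)`.  A NON-coupling-blind member of DEF-1's Z family
with its level-0 face in the tree. [cite: Balaban1989LargeFieldII, (0.1) pp.355–356; Balaban1988Convergent, (2.50) p.264, Thm 1 p.262, (1.15) p.249; Balaban1987RG1, (0.15) p.254, (0.20) p.256] -/
theorem uv_zero_densOfRecord₁₃_theta13OfThm1CCMWZB_printedZ_eflZero_of_inInterval_of_invSqFloor {ε γ' M : ℝ} (hε : 0 < ε) (hγ' : γ' ≤ 1) (hM : 0 ≤ M) (P : B12.RunParams)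
    (hfl : ∀ i, i ≤ P.K → (gOfRecord₁₃ F N (theta13OfThm1CCMWZB F N j γ εbg ε₀ ε₂₉ B₃ B₃' a₀ a₁ (fun _ _ => 0) (fun _ _ => 0)) P i ^ 2)⁻¹ ≤ (P.g0 ^ 2)⁻¹ + M)
    (hI : (genFlow (betaOfRecord₁₃ F N (theta13OfThm1CCMWZB F N j γ εbg ε₀ ε₂₉ B₃ B₃' a₀ a₁ (fun _ _ => 0) (fun _ _ => 0))) P.g0).InInterval γ' P.K) (U : GaugeField (F.P P.K) 0 (SU N)) :
    chiβOfRecord₁₃ F N (theta13OfThm1CCMWZB F N j γ εbg ε₀ ε₂₉ B₃ B₃' a₀ a₁ (fun _ _ => 0) (fun _ _ => 0)) P.K (gOfRecord₁₃ F N (theta13OfThm1CCMWZB F N j γ εbg ε₀ ε₂₉ B₃ B₃' a₀ a₁ (fun _ _ => 0) (fun _ _ => 0)) P) 0 U *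
          Real.exp (-(1 / (gOfRecord₁₃ F N (theta13OfThm1CCMWZB F N j γ εbg ε₀ ε₂₉ B₃ B₃' a₀ a₁ (fun _ _ => 0) (fun _ _ => 0)) P 0)) ^ 2 *
              wilsonBGOfRecord F N (theta13OfThm1CCMWZB F N j γ εbg ε₀ ε₂₉ B₃ B₃' a₀ a₁ (fun _ _ => 0) (fun _ _ => 0)).εbg P 0 U
            - (4 * max (numerics7OfThm1CCM F.L j ε₀ B₃ B₃' a₀ a₁).logσ₀ 0 + B16ZLower.CzSU N ε
                + 12 * (1 / gOfRecord₁₃ F N (theta13OfThm1CCMWZB F N j γ εbg ε₀ ε₂₉ B₃ B₃' a₀ a₁ (fun _ _ => 0) (fun _ _ => 0)) P 0) ^ 2) * (Fintype.card (Site (F.P P.K) 0) : ℝ)) ≤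
        densOfRecord₁₃ F N (theta13OfThm1CCMWZB F N j γ εbg ε₀ ε₂₉ B₃ B₃' a₀ a₁ (fun _ _ => 0)
          (fun p i => Real.log (B16ZLower.zNorm (SU N) (gOfRecord₁₃ F N (theta13OfThm1CCMWZB F N j γ εbg ε₀ ε₂₉ B₃ B₃' a₀ a₁ (fun _ _ => 0) (fun _ _ => 0)) p i ^ 2) ε))) P 0 U ∧
      densOfRecord₁₃ F N (theta13OfThm1CCMWZB F N j γ εbg ε₀ ε₂₉ B₃ B₃' a₀ a₁ (fun _ _ => 0)
          (fun p i => Real.log (B16ZLower.zNorm (SU N) (gOfRecord₁₃ F N (theta13OfThm1CCMWZB F N j γ εbg ε₀ ε₂₉ B₃ B₃' a₀ a₁ (fun _ _ => 0) (fun _ _ => 0)) p i ^ 2) ε))) P 0 U ≤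
        Real.exp ((4 * ((dimSU N : ℕ) : ℝ) * (Real.log (gOfRecord₁₃ F N (theta13OfThm1CCMWZB F N j γ εbg ε₀ ε₂₉ B₃ B₃' a₀ a₁ (fun _ _ => 0) (fun _ _ => 0)) P 0)⁻¹ + M / 2)
            + 4 * max (-(numerics7OfThm1CCM F.L j ε₀ B₃ B₃' a₀ a₁).logσ₀) 0) * (Fintype.card (Site (F.P P.K) 0) : ℝ)) := by
  have h := uv_zero_densOfRecord₁₃_theta13OfThm1CCMWZB_printedZ_of_eflAbs_of_inInterval_of_invSqFloor F N j γ εbg ε₀ ε₂₉ B₃ B₃' a₀ a₁ (fun _ _ => 0)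
    hε le_rfl hγ' hM P (fun i _ => by simp) hfl hI U
  simp only [add_zero] at h
  exact h

end Summit.QuantumFields.YangMills.BalabanUVNodes.N13UV01LevelZeroAtThm1CCMWZBOfPrintedZ
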